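import Summits.QuantumFields.YangMills.Theorems.BalabanUVNodesN26AtRecord12B13Family
import Literature.MathematicalPhysics.QuantumFieldTheory.Balaban1983to89.Node00.Record12NumericsFamily
import Mathlib.Analysis.Complex.ExponentialBounds

/-!
# DAG node N26 — B4 «β-continuity» AT THE STAGE-12 RECORD: THE SUFFICIENT SIDE OF THE LOCATED κ-DEMAND.  N1's `CondsL` at the LETTERS OF RECORD in four
# numeral rows (two on the RECORD's (I.1.18) rate `θ.s2.lf.κ` given `L`, two on the RESIDUAL letters given `(κ, E₀, L)`); the threshold `20·(64·log 162 + 1) ≤ θ.s2.lf.κ`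
# pays both record rows for EVERY `L ≥ 3` and is SHARP at `L = 3`; non-vacuity after the re-pin (p479720 §1's `hC` slot is then inhabited, and filled by name)

Cell `pub-ymgap`, YM-PLAN Track A (HUMAN RULING D-0062), seat `pub-ymgap-dag-n26-c` gen 5 (R134 acceleration seat, s2; harness re-seat).  Follows this seat's v1.1
`…N26AtRecord12B13Family` §2 `Located` (p479720: `CondsL 4 (c13OfRecord₁₂ θ c₀) ℓ` FORCES `128·log 162 ≤ θ.s2.lf.κ`; at NODE 00's displayed default `κ = 1` — K0′'s
witness `theta12OfRecord` — §1 there is VACUOUS), dag-lead's FLAG-K0′-KAPPA (§ K0′ row P13 «κ-rate»), dag-ref-D g24's READ #136 ∕ WATCH-D4-KAPPA-AT-RECORD, and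
director-ym LINE №125 «RECORD 13» (the witness re-pin of the numerics: «κ large; name the values and the print locus»; CLOSABILITY GATE: every row ⟸ a landed theorem).

WHY THIS FILE.  §2 `Located` of p479720 typed the NECESSARY side of N26's demand on the record.  This file types the SUFFICIENT side, so that (a) the Record-13
numerics re-pin has N26 ∕ (D4)'s row as ONE kernel-checked number, (b) after the re-pin the family road's `hC` is NOT vacuous (residual letters meeting N1 exist at every
such tuple), and (c) p479720 §1's reductions apply with `hC` supplied BY NAME from `hκ` on the record plus the two residual rows — the positive form the ₁₃ re-read asks for.

WHAT IS HERE (0 `def`, 0 `sorry`; located numerals over tree definitions).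
§1 `CondsL 4 (c13OfRecord₁₂ F N θ c₀) (½L)` IN NUMERALS: `condsL_c13OfRecord₁₂_half_iff` — [KP-large `10·(64·log 162 + 1) ≤ (½(ℓ₆+1) − 1)·θ.s2.lf.κ`] ∧
[small `C3act·c₀.ε₁·e^{5κ+1}·K₀(64,8)·9·64 ≤ 1`] ∧ [`e·9·64·K₀(64,8)² ≤ c₀.A₂`] ∧ [tree `128·log 162 ≤ θ.s2.lf.κ`]; the face `C3act_c13OfRecord₁₂` (Lemma 3's activity
constant at the letters reads the record's `L` and `E₀`, the rest residual); `kpLarge_tree_of_kappa_ge` (`20·(64·log 162 + 1) ≤ θ.s2.lf.κ` ⟹ both record rows for EVERY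
`L ≥ 3`, def-B13's `three_le_ell6_succ`); `condsL_c13OfRecord₁₂_half_iff_of_kappa_ge` (then `CondsL` ↔ the two residual rows) and `condsL_c13OfRecord₁₂_half_of_kappa_ge`;
`kappa_ge_of_condsL_c13OfRecord₁₂_half_of_L_eq_three` (NECESSITY at `L = 3`: the threshold is sharp over all tuples); numerals `log_162_le`, `kappaThreshold_le_6600`,
`kappaThreshold_le_2e4` and `condsL_c13OfRecord₁₂_half_of_kappa_ge_2e4` (dag-n10-d's proposed common re-pin value `2·10⁴`, p482076); `small_c13OfRecord₁₂_iff_eps_le`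
(print's «ε₁ sufficiently small» as the explicit threshold `c₀.ε₁ ≤ 1 ∕ (C3act·e^{5κ+1}·K₀(64,8)·576)` when `C3act > 0`).
§2 NON-VACUITY AFTER THE RE-PIN: `exists_condsL_c13OfRecord₁₂_half_of_kappa_ge` — at every tuple with `20·(64·log 162 + 1) ≤ θ.s2.lf.κ` and any residual `c₀`, letters
differing from `c₀` only in `ε₁ > 0` and `A₂` meet N1 at ℓ = ½L.
§3 AT NODE 00's κ-RE-PINNED WITNESSES OF THE FAMILY (node00-def-K0a `Node00.Record12NumericsFamily`, landed: `theta12OfFamily F N ε₀ ζ Rz Zt` ∕ its live re-pin,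
`κ := 2·10⁴`, `ℓ₆ = 2`, `E₀ = 1` by `rfl`; K0a's `kp_n10_theta12OfFamily`): `condsL_c13OfRecord₁₂_theta12OfFamily_iff` ∕ `…theta12LiveOfFamily_iff` — N1 at the letters of
record of the re-pinned witness ⟺ [`1250·A₁·K₀(c₀)·ε₁·e^{100001}·K₀(64,8)·576 ≤ 1`] ∧ [`e·576·K₀(64,8)² ≤ A₂`], BOTH RECORD ROWS DISCHARGED — the positive counterpart of
p479720's `not_condsL_c13OfRecord₁₂_theta12OfRecord`; `exists_condsL_c13OfRecord₁₂_theta12OfFamily` ∕ `…theta12LiveOfFamily` — NON-VACUITY BY NAME at the witness.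
USE (the gate's dedup lint forbids restating p479720 §1 with the slot filled): at a κ-re-pinned tuple the term
`condsL_c13OfRecord₁₂_half_of_kappa_ge F N θ c₀ hκ hsm hA₂` (or `…_2e4`) IS p479720 §1's hypothesis `hC` — so `exists_chainTFac190H_view_of_family`,
`betaContH_view_of_family`, `n26_datumOfRecord₁₂_of_family`, `d4AtSlopeOfD1Record12_at_of_family(_leafwise)` apply with `hC` DISCHARGED modulo `hκ` on the record and the
two residual rows; at a Record-13 witness carrying the re-pinned numeral, `hκ` closes by `norm_num` on the `rfl` face of its `s2.lf.κ`.

HONEST FRAMING.  Bookkeeping over tree numerals (`TreeLengthCubeSystem.kappa₀_four`: κ₀ = 64·log 162; `RemainderChainKP.large_iff_of_R22gen`; def-B13's letters of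
record) — a located reading of print's «κ sufficiently large» ∕ «ε₁ sufficiently small» ([I] p. 257 after (0.25); [II] p. 21 L9), NOT an estimate of Bałaban's and NOT a
value Bałaban prints (print fixes no numeral).  (D4) INSTANCE 0∕1; crux K2′'s `stub_d4AtSlopeCont12` NOT proved (§3 is p479720 §1's REDUCTION re-read); N10 ∕ N25 ∕ N26
NOT discharged; counts unmoved.  One finite four-torus programme at fixed ε per run — NOT the continuum limit, NOT ℝ⁴, NOT OS, NOT a mass gap, NOT Clay.
Sources (context): [I] = [Balaban1987RG1] CMP **109** (1987): (0.25)–(0.26) p. 257, (1.18) p. 263, Thm 3 p. 264; [II] = [Balaban1988RG2Cluster] CMP **116** (1988):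
(1.26) p. 8, Lemma 3 (2.38) p. 20, p. 21 (after (2.39) and after (2.41)); [15] = [Balaban1985Variational] CMP **102** (1985): (190) p. 308.
-/

noncomputable section

open scoped Matrix.Norms.L2Operator

namespace Summit.QuantumFields.YangMills.Theorems.BalabanUVNodesN26AtRecord12KappaSufficient

open Literature.MathematicalPhysics.QuantumFieldTheory.Balaban1983to89
open Literature.MathematicalPhysics.QuantumFieldTheory.Balaban1983to89.T4Continuum (T4Family)
open Literature.MathematicalPhysics.QuantumFieldTheory.Balaban1983to89.Node00
open Literature.MathematicalPhysics.QuantumFieldTheory.Balaban1983to89.B12TreeDecay (K₀ K₀_pos)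
open Literature.MathematicalPhysics.QuantumFieldTheory.Balaban1983to89.Beta.RemainderChainLattice
open Literature.MathematicalPhysics.QuantumFieldTheory.Balaban1983to89.Beta.RemainderChainKP (large_iff_of_R22gen)
open Summit.QuantumFields.YangMills.Theorems.BalabanUVNodesN26AtRecord12B13Family

variable (F : T4Family) (N : ℕ) [NeZero N]

/-! ## §1 N1 `CondsL` AT THE LETTERS OF RECORD AND ℓ = ½L, IN NUMERALS: two rows on the RECORD's κ given L, two rows on the RESIDUAL letters given (κ, E₀, L) -/

section Numerals

variable (θ : Stage12Params F N) (c₀ : B13.Consts)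

/-- Face: `A₂` (the printed O(1) of (2.41)) stays residual at the letters of record. [cite: Balaban1988RG2Cluster, (2.41) p.21 (bookkeeping)] -/
theorem c13OfRecord₁₂_A₂ : (c13OfRecord₁₂ F N θ c₀).A₂ = c₀.A₂ := rfl

/-- Face: the `E₀`-, `ε₁`-free kernel `2C₁α₄⁻¹α₆⁻¹M^q e^{C₂κ₁}` of p. 19's `ε₂` stays residual at the letters of record. [cite: Balaban1988RG2Cluster, p.19 (definition of ε₂; bookkeeping)] -/
theorem K₀_c13OfRecord₁₂ : (c13OfRecord₁₂ F N θ c₀).K₀ = c₀.K₀ := rfl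

/-- **Face: Lemma 3's activity constant AT THE LETTERS OF RECORD reads the RECORD's block size `L = ℓ₆ + 1` and (I.1.18)'s `E₀ = θ.s2.lf.E₀`**, the printed O(1) `A₁` and
the kernel `2C₁α₄⁻¹α₆⁻¹M^q e^{C₂κ₁}` staying residual: `C₃ = 2(L+2)⁴·A₁·(E₀·K₀(c₀))` (p. 20 «We define the constant C₃ = 2(L+2)⁴O(1)2E₀C₁α₄⁻¹α₆⁻¹M^q exp C₂κ₁»).
[cite: Balaban1988RG2Cluster, p.20 (definition of C₃) and p.21 («we define ½E₀ as equal to this constant»)] -/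
theorem C3act_c13OfRecord₁₂ :
    (c13OfRecord₁₂ F N θ c₀).C3act = 2 * ((((θ.ℓ₆ + 1 : ℕ) : ℝ)) + 2) ^ 4 * c₀.A₁ * (θ.s2.lf.E₀ * c₀.K₀) := rfl

/-- **N1 AT THE LETTERS OF RECORD AND ℓ = ½L, IN NUMERALS** (`RemainderChainLattice.condsL_four_iff` with N2's R22 — an identity of the letters, `r22gen_half_c13OfRecord₁₂` —
turning `large` into its Kotecký–Preiss form, `RemainderChainKP.large_iff_of_R22gen`): `CondsL 4 (c13OfRecord₁₂ θ c₀) (½L)` ⟺ [KP-large `10·(64·log 162 + 1) ≤ (½L − 1)·κ`]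
∧ [small `C₃·ε₁·e^{5κ+1}·K₀(64,8)·9·64 ≤ 1`] ∧ [`e·9·64·K₀(64,8)² ≤ A₂`] ∧ [tree `128·log 162 ≤ κ`], with `κ = θ.s2.lf.κ`, `L = ℓ₆ + 1` THE RECORD's and `ε₁`, `A₂` (and
`C₃` but for `L`, `E₀`) THE RESIDUAL letters'.  Rows 1 and 4 are demands on NODE 00's witness; rows 2 and 3 are [II]'s «ε₁ sufficiently small» and the printed O(1) of (2.41).
[cite: Balaban1988RG2Cluster, p.21 (after (2.39): «for κ sufficiently large, and ε₁ sufficiently small»; after (2.41)); Balaban1987RG1, (0.25)-(0.26) p.257 and (1.18) p.263] -/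
theorem condsL_c13OfRecord₁₂_half_iff :
    CondsL 4 (c13OfRecord₁₂ F N θ c₀) (((c13OfRecord₁₂ F N θ c₀).L : ℝ) / 2) ↔
      10 * (64 * Real.log 162 + 1) ≤ ((((θ.ℓ₆ + 1 : ℕ) : ℝ)) / 2 - 1) * θ.s2.lf.κ ∧
        (c13OfRecord₁₂ F N θ c₀).C3act * c₀.ε₁ * Real.exp (5 * θ.s2.lf.κ + 1) * K₀ 64 8 * 9 * 64 ≤ 1 ∧
          Real.exp 1 * 9 * 64 * K₀ 64 8 ^ 2 ≤ c₀.A₂ ∧ 128 * Real.log 162 ≤ θ.s2.lf.κ := by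
  rw [condsL_four_iff, large_iff_of_R22gen _ (r22gen_half_c13OfRecord₁₂ F N θ c₀) (64 * Real.log 162), c13OfRecord₁₂_κ,
    c13OfRecord₁₂_ε₁, c13OfRecord₁₂_L]
  exact Iff.rfl

/-- `log 162 ≤ 5.140625` (`e⁵ > 148.41` from `e > 2.7182818283`, `e^{0.140625} ≥ 1.140625`). [cite: Balaban1988RG2Cluster, (1.26) p.8 (bookkeeping numeral)] -/
theorem log_162_le : Real.log 162 ≤ 5.140625 := by
  rw [Real.log_le_iff_le_exp (by norm_num)]
  have h5 : (148.41 : ℝ) ≤ Real.exp 5 := by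
    calc (148.41 : ℝ) ≤ 2.7182818283 ^ 5 := by norm_num
      _ ≤ Real.exp 1 ^ 5 := pow_le_pow_left₀ (by norm_num) Real.exp_one_gt_d9.le 5
      _ = Real.exp 5 := by rw [← Real.exp_nat_mul]; norm_num
  have h1 : (1.140625 : ℝ) ≤ Real.exp 0.140625 := by
    have := Real.add_one_le_exp (0.140625 : ℝ)
    linarith
  calc (162 : ℝ) ≤ 148.41 * 1.140625 := by norm_num
    _ ≤ Real.exp 5 * Real.exp 0.140625 := mul_le_mul h5 h1 (by norm_num) (Real.exp_pos _).le
    _ = Real.exp 5.140625 := by rw [← Real.exp_add]; norm_num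

/-- The record-side threshold in an integer: `20·(64·log 162 + 1) ≤ 6600` (its value is ≈ 6532.2). [cite: Balaban1988RG2Cluster, p.21 (after (2.39); bookkeeping numeral)] -/
theorem kappaThreshold_le_6600 : 20 * (64 * Real.log 162 + 1) ≤ 6600 := by
  have := log_162_le
  linarith

/-- … and below dag-n10-d's proposed common re-pin value for Record 13 (p482076 `thresholds_of_kappa_ge`: N10's Lemma 1–2 rate rows at `2·10⁴ ≤ θ.s2.lf.κ`):
`20·(64·log 162 + 1) ≤ 2·10⁴`. [cite: Balaban1988RG2Cluster, p.21 (after (2.39); bookkeeping numeral)] -/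
theorem kappaThreshold_le_2e4 : 20 * (64 * Real.log 162 + 1) ≤ 2 * 10 ^ 4 := by
  have := log_162_le
  linarith

/-- **THE SUFFICIENT SIDE ON THE RECORD**: `20·(64·log 162 + 1) ≤ θ.s2.lf.κ` pays BOTH record rows of N1 at the letters of record — the Kotecký–Preiss «κ large» at ℓ = ½L
and the (1.26) tree row — for EVERY admissible block size (`L = ℓ₆ + 1 ≥ 3`, def-B13's `three_le_ell6_succ`; at `L = 3`, `½L − 1 = ½`).
[cite: Balaban1988RG2Cluster, p.21 (after (2.39)) and (1.26) p.8; Balaban1987RG1, (0.25)-(0.26) p.257] -/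
theorem kpLarge_tree_of_kappa_ge (hκ : 20 * (64 * Real.log 162 + 1) ≤ θ.s2.lf.κ) :
    10 * (64 * Real.log 162 + 1) ≤ ((((θ.ℓ₆ + 1 : ℕ) : ℝ)) / 2 - 1) * θ.s2.lf.κ ∧ 128 * Real.log 162 ≤ θ.s2.lf.κ := by
  have hlog : 0 ≤ Real.log 162 := Real.log_nonneg (by norm_num)
  have hL : (3 : ℝ) ≤ ((θ.ℓ₆ + 1 : ℕ) : ℝ) := by exact_mod_cast three_le_ell6_succ F N θ
  have hκ0 : 0 ≤ θ.s2.lf.κ := by linarith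
  have hhalf : (1 / 2 : ℝ) * θ.s2.lf.κ ≤ ((((θ.ℓ₆ + 1 : ℕ) : ℝ)) / 2 - 1) * θ.s2.lf.κ :=
    mul_le_mul_of_nonneg_right (by linarith) hκ0
  exact ⟨by linarith, by linarith⟩

/-- **AT A TUPLE WHOSE (I.1.18) RATE MEETS THE THRESHOLD, N1 AT THE LETTERS OF RECORD IS A CONDITION ON THE RESIDUAL LETTERS ONLY**: «ε₁ sufficiently small» (given the
record's κ, E₀, L) and the printed O(1) of (2.41). [cite: Balaban1988RG2Cluster, p.21 (after (2.39): «for κ sufficiently large, and ε₁ sufficiently small»; after (2.41))] -/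
theorem condsL_c13OfRecord₁₂_half_iff_of_kappa_ge (hκ : 20 * (64 * Real.log 162 + 1) ≤ θ.s2.lf.κ) :
    CondsL 4 (c13OfRecord₁₂ F N θ c₀) (((c13OfRecord₁₂ F N θ c₀).L : ℝ) / 2) ↔
      (c13OfRecord₁₂ F N θ c₀).C3act * c₀.ε₁ * Real.exp (5 * θ.s2.lf.κ + 1) * K₀ 64 8 * 9 * 64 ≤ 1 ∧
        Real.exp 1 * 9 * 64 * K₀ 64 8 ^ 2 ≤ c₀.A₂ := by
  have h := kpLarge_tree_of_kappa_ge F N θ hκ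
  rw [condsL_c13OfRecord₁₂_half_iff]
  exact ⟨fun hC => ⟨hC.2.1, hC.2.2.1⟩, fun hC => ⟨h.1, hC.1, hC.2, h.2⟩⟩

/-- **N1 AT THE LETTERS OF RECORD FROM THE THRESHOLD AND THE TWO RESIDUAL ROWS.** [cite: Balaban1988RG2Cluster, p.21 (after (2.39) and after (2.41)); Balaban1987RG1, (0.25)-(0.26) p.257] -/
theorem condsL_c13OfRecord₁₂_half_of_kappa_ge (hκ : 20 * (64 * Real.log 162 + 1) ≤ θ.s2.lf.κ)
    (hsm : (c13OfRecord₁₂ F N θ c₀).C3act * c₀.ε₁ * Real.exp (5 * θ.s2.lf.κ + 1) * K₀ 64 8 * 9 * 64 ≤ 1)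
    (hA₂ : Real.exp 1 * 9 * 64 * K₀ 64 8 ^ 2 ≤ c₀.A₂) :
    CondsL 4 (c13OfRecord₁₂ F N θ c₀) (((c13OfRecord₁₂ F N θ c₀).L : ℝ) / 2) :=
  (condsL_c13OfRecord₁₂_half_iff_of_kappa_ge F N θ c₀ hκ).2 ⟨hsm, hA₂⟩

/-- **… AT dag-n10-d's PROPOSED COMMON RE-PIN VALUE `2·10⁴ ≤ θ.s2.lf.κ`** (p482076: the same re-pin pays N10's Lemma 1–2 rate rows) — so ONE witness value serves N10 and
N26 ∕ (D4) on the record side. [cite: Balaban1988RG2Cluster, p.21 (after (2.39) and after (2.41)); Balaban1987RG1, (1.18) p.263] -/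
theorem condsL_c13OfRecord₁₂_half_of_kappa_ge_2e4 (hκ : 2 * 10 ^ 4 ≤ θ.s2.lf.κ)
    (hsm : (c13OfRecord₁₂ F N θ c₀).C3act * c₀.ε₁ * Real.exp (5 * θ.s2.lf.κ + 1) * K₀ 64 8 * 9 * 64 ≤ 1)
    (hA₂ : Real.exp 1 * 9 * 64 * K₀ 64 8 ^ 2 ≤ c₀.A₂) :
    CondsL 4 (c13OfRecord₁₂ F N θ c₀) (((c13OfRecord₁₂ F N θ c₀).L : ℝ) / 2) :=
  condsL_c13OfRecord₁₂_half_of_kappa_ge F N θ c₀ (kappaThreshold_le_2e4.trans hκ) hsm hA₂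

/-- **NECESSITY AT `L = 3`: THE THRESHOLD IS SHARP OVER ALL TUPLES** — at the smallest admissible block size the Kotecký–Preiss row reads `10·(64·log 162 + 1) ≤ ½κ`.
(For larger `L` the record rows only need `max {128·log 162, 10·(64·log 162 + 1)∕(½L − 1)} ≤ κ`, p479720 `kappa_lower_of_condsL_c13OfRecord₁₂` ∕ `condsL_large_c13OfRecord₁₂_half_iff`.)
[cite: Balaban1988RG2Cluster, p.21 (after (2.39)); Balaban1987RG1, Thm 1 p.259 (L odd, bookkeeping)] -/
theorem kappa_ge_of_condsL_c13OfRecord₁₂_half_of_L_eq_three (hL : θ.ℓ₆ + 1 = 3)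
    (hC : CondsL 4 (c13OfRecord₁₂ F N θ c₀) (((c13OfRecord₁₂ F N θ c₀).L : ℝ) / 2)) : 20 * (64 * Real.log 162 + 1) ≤ θ.s2.lf.κ := by
  obtain ⟨h1, -, -, -⟩ := (condsL_c13OfRecord₁₂_half_iff F N θ c₀).1 hC
  rw [hL] at h1
  norm_num at h1
  linarith

/-- **«ε₁ SUFFICIENTLY SMALL» AS THE EXPLICIT THRESHOLD**: when Lemma 3's activity constant at the letters is positive, the `small` row is
`ε₁ ≤ 1 ∕ (C₃·e^{5κ+1}·K₀(64,8)·9·64)` — given the record's κ, E₀, L a condition on the residual `ε₁` alone (for `C₃ ≤ 0` it holds at every `ε₁ ≥ 0`).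
[cite: Balaban1988RG2Cluster, p.21 (after (2.39): «and ε₁ sufficiently small»), p.20 (definition of C₃)] -/
theorem small_c13OfRecord₁₂_iff_eps_le (hP : 0 < (c13OfRecord₁₂ F N θ c₀).C3act) :
    (c13OfRecord₁₂ F N θ c₀).C3act * c₀.ε₁ * Real.exp (5 * θ.s2.lf.κ + 1) * K₀ 64 8 * 9 * 64 ≤ 1 ↔
      c₀.ε₁ ≤ 1 / ((c13OfRecord₁₂ F N θ c₀).C3act * Real.exp (5 * θ.s2.lf.κ + 1) * K₀ 64 8 * 9 * 64) := by
  have hK := K₀_pos 64 8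
  have hpos : 0 < (c13OfRecord₁₂ F N θ c₀).C3act * Real.exp (5 * θ.s2.lf.κ + 1) * K₀ 64 8 * 9 * 64 := by positivity
  rw [le_div_iff₀ hpos]
  have e : c₀.ε₁ * ((c13OfRecord₁₂ F N θ c₀).C3act * Real.exp (5 * θ.s2.lf.κ + 1) * K₀ 64 8 * 9 * 64) =
      (c13OfRecord₁₂ F N θ c₀).C3act * c₀.ε₁ * Real.exp (5 * θ.s2.lf.κ + 1) * K₀ 64 8 * 9 * 64 := by ring
  rw [e]

/-- The `small` row at `C₃ ≤ 0` (degenerate sign of `A₁·E₀·C₁α₄⁻¹α₆⁻¹M^q`) holds at every `ε₁ ≥ 0`. [cite: Balaban1988RG2Cluster, p.20 (definition of C₃; bookkeeping)] -/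
theorem small_c13OfRecord₁₂_of_C3act_nonpos (hP : (c13OfRecord₁₂ F N θ c₀).C3act ≤ 0) (hε : 0 ≤ c₀.ε₁) :
    (c13OfRecord₁₂ F N θ c₀).C3act * c₀.ε₁ * Real.exp (5 * θ.s2.lf.κ + 1) * K₀ 64 8 * 9 * 64 ≤ 1 := by
  have hK := K₀_pos 64 8
  have h1 : (c13OfRecord₁₂ F N θ c₀).C3act * c₀.ε₁ ≤ 0 := mul_nonpos_of_nonpos_of_nonneg hP hε
  have h2 : 0 ≤ Real.exp (5 * θ.s2.lf.κ + 1) * K₀ 64 8 * 9 * 64 := by positivity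
  have e : (c13OfRecord₁₂ F N θ c₀).C3act * c₀.ε₁ * Real.exp (5 * θ.s2.lf.κ + 1) * K₀ 64 8 * 9 * 64 =
      (c13OfRecord₁₂ F N θ c₀).C3act * c₀.ε₁ * (Real.exp (5 * θ.s2.lf.κ + 1) * K₀ 64 8 * 9 * 64) := by ring
  rw [e]
  linarith [mul_nonpos_of_nonpos_of_nonneg h1 h2]

end Numerals

/-! ## §2 NON-VACUITY AFTER THE RE-PIN: at every tuple meeting the threshold, residual letters meeting N1 at ℓ = ½L EXIST (the converse face of p479720 §2 `Located`) -/

section NonVacuity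

variable (θ : Stage12Params F N)

/-- **AFTER THE κ RE-PIN, `hC` IS SATISFIABLE**: at every Stage-12 tuple with `20·(64·log 162 + 1) ≤ θ.s2.lf.κ` and for any residual letters `c₀`, the letters that differ
from `c₀` only in `ε₁ := 1∕(|C₃·e^{5κ+1}·K₀(64,8)·576| + 1) > 0` and `A₂ := e·9·64·K₀(64,8)²` satisfy `CondsL 4 (c13OfRecord₁₂ θ ·) (½L)`.  So a Record-13 witness carrying
the re-pinned κ makes p479720 §1 NON-vacuous in its `hC` slot — the opposite of `not_condsL_c13OfRecord₁₂_theta12OfRecord` at the ₁₂ default `κ = 1`.  (A satisfiability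
certificate for ONE displayed hypothesis; the other displayed inputs of the family road are untouched; nothing of Bałaban's.)
[cite: Balaban1988RG2Cluster, p.21 (after (2.39): «for κ sufficiently large, and ε₁ sufficiently small»; after (2.41)); Balaban1987RG1, (0.25)-(0.26) p.257] -/
theorem exists_condsL_c13OfRecord₁₂_half_of_kappa_ge (hκ : 20 * (64 * Real.log 162 + 1) ≤ θ.s2.lf.κ) (c₀ : B13.Consts) :
    ∃ c : B13.Consts, 0 < c.ε₁ ∧ c = { c₀ with ε₁ := c.ε₁, A₂ := c.A₂ } ∧
      CondsL 4 (c13OfRecord₁₂ F N θ c) (((c13OfRecord₁₂ F N θ c).L : ℝ) / 2) := by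
  set P : ℝ := (c13OfRecord₁₂ F N θ c₀).C3act * Real.exp (5 * θ.s2.lf.κ + 1) * K₀ 64 8 * 9 * 64 with hP
  refine ⟨{ c₀ with ε₁ := 1 / (|P| + 1), A₂ := Real.exp 1 * 9 * 64 * K₀ 64 8 ^ 2 }, by positivity, rfl, ?_⟩
  refine condsL_c13OfRecord₁₂_half_of_kappa_ge F N θ _ hκ ?_ le_rfl
  show (c13OfRecord₁₂ F N θ c₀).C3act * (1 / (|P| + 1)) * Real.exp (5 * θ.s2.lf.κ + 1) * K₀ 64 8 * 9 * 64 ≤ 1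
  have e : (c13OfRecord₁₂ F N θ c₀).C3act * (1 / (|P| + 1)) * Real.exp (5 * θ.s2.lf.κ + 1) * K₀ 64 8 * 9 * 64 =
      P / (|P| + 1) := by rw [hP]; ring
  rw [e, div_le_one (by positivity)]
  exact (le_abs_self P).trans (by linarith)

end NonVacuity


/-! ## §3 AT NODE 00's κ-RE-PINNED WITNESSES OF THE FAMILY (node00-def-K0a `Node00.Record12NumericsFamily`: `κ := 2·10⁴`, `ℓ₆ = 2`, `E₀ = 1`, all `rfl`): N1 at the letters
of record IS the two residual rows — BY NAME, the positive counterpart of p479720's `not_condsL_c13OfRecord₁₂_theta12OfRecord` at the ₁₂ default `κ = 1` -/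

section AtFamilyWitness

variable (ε₀ : ℝ) (ζ : ZetaOfRecord F N (numerics7OfFamily ε₀) 1) (Rz : (K : ℕ) → Sect2.Residual (F.P K) (MatA N))
  (Zt : (K : ℕ) → TkResidualW F N (FluctV N) K) (c₀ : B13.Consts)

/-- The record-side threshold holds AT `θ₀ᶠᵃᵐ(ε₀)` (K0a's `kp_n10_theta12OfFamily`: `2·10⁴ ≤ κ`, and `kappaThreshold_le_2e4`). [cite: Balaban1988RG2Cluster, p.21 (after (2.39)); Balaban1987RG1, (1.18) p.263 (bookkeeping numeral)] -/
theorem kappaThreshold_le_theta12OfFamily : 20 * (64 * Real.log 162 + 1) ≤ (theta12OfFamily F N ε₀ ζ Rz Zt).s2.lf.κ :=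
  kappaThreshold_le_2e4.trans (kp_n10_theta12OfFamily F N ε₀ ζ Rz Zt)

/-- … and AT the live re-pin `θ₀ᶠᵃᵐ,ˡⁱᵛᵉ(ε₀)` (same `s2`, `Stage12Params.liveRepin_s2`). [cite: Balaban1988RG2Cluster, p.21 (after (2.39)); Balaban1987RG1, (1.18) p.263 (bookkeeping numeral)] -/
theorem kappaThreshold_le_theta12LiveOfFamily : 20 * (64 * Real.log 162 + 1) ≤ (theta12LiveOfFamily F N ε₀ ζ Rz Zt).s2.lf.κ :=
  kappaThreshold_le_theta12OfFamily F N ε₀ ζ Rz Zt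

/-- **Face: Lemma 3's activity constant at the letters of record OF `θ₀ᶠᵃᵐ(ε₀)`** (`L = 3`, `E₀ = 1`): `C₃ = 2·5⁴·A₁·K₀(c₀) = 1250·A₁·(2C₁α₄⁻¹α₆⁻¹M^q e^{C₂κ₁})` —
residual letters only. [cite: Balaban1988RG2Cluster, p.20 (definition of C₃; bookkeeping numeral)] -/
theorem C3act_c13OfRecord₁₂_theta12OfFamily : (c13OfRecord₁₂ F N (theta12OfFamily F N ε₀ ζ Rz Zt) c₀).C3act = 1250 * c₀.A₁ * c₀.K₀ := by
  rw [C3act_c13OfRecord₁₂, theta12OfFamily_ℓ₆, show (theta12OfFamily F N ε₀ ζ Rz Zt).s2.lf.E₀ = 1 from rfl]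
  norm_num

/-- **N1 AT THE LETTERS OF RECORD OF THE RE-PINNED WITNESS `θ₀ᶠᵃᵐ(ε₀)` IS THE TWO RESIDUAL ROWS** — both record rows DISCHARGED by the re-pinned numeral (`κ = 2·10⁴`,
`rfl`): `CondsL 4 (c13OfRecord₁₂ θ₀ᶠᵃᵐ c₀) (½L)` ⟺ [`1250·A₁·K₀(c₀)·ε₁·e^{100001}·K₀(64,8)·576 ≤ 1`] ∧ [`e·576·K₀(64,8)² ≤ A₂`].  The positive counterpart, at NODE 00's
re-pinned witness, of `not_condsL_c13OfRecord₁₂_theta12OfRecord` (p479720 §2) at the ₁₂ default `κ = 1`; what «ε₁ sufficiently small» costs at this κ is displayed.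
[cite: Balaban1988RG2Cluster, p.21 (after (2.39): «for κ sufficiently large, and ε₁ sufficiently small»; after (2.41)); Balaban1987RG1, (0.25)-(0.26) p.257 and (1.18) p.263] -/
theorem condsL_c13OfRecord₁₂_theta12OfFamily_iff :
    CondsL 4 (c13OfRecord₁₂ F N (theta12OfFamily F N ε₀ ζ Rz Zt) c₀) (((c13OfRecord₁₂ F N (theta12OfFamily F N ε₀ ζ Rz Zt) c₀).L : ℝ) / 2) ↔
      1250 * c₀.A₁ * c₀.K₀ * c₀.ε₁ * Real.exp (5 * 20000 + 1) * K₀ 64 8 * 9 * 64 ≤ 1 ∧ Real.exp 1 * 9 * 64 * K₀ 64 8 ^ 2 ≤ c₀.A₂ := by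
  rw [condsL_c13OfRecord₁₂_half_iff_of_kappa_ge F N _ c₀ (kappaThreshold_le_theta12OfFamily F N ε₀ ζ Rz Zt), C3act_c13OfRecord₁₂_theta12OfFamily,
    theta12OfFamily_κ]

/-- **… and AT the live re-pin `θ₀ᶠᵃᵐ,ˡⁱᵛᵉ(ε₀)`** (K0′'s rung-A witness; `liveRepin` keeps `s2` and `ℓ₆`). [cite: Balaban1988RG2Cluster, p.21 (after (2.39) and after (2.41)); Balaban1987RG1, (1.18) p.263] -/
theorem condsL_c13OfRecord₁₂_theta12LiveOfFamily_iff :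
    CondsL 4 (c13OfRecord₁₂ F N (theta12LiveOfFamily F N ε₀ ζ Rz Zt) c₀) (((c13OfRecord₁₂ F N (theta12LiveOfFamily F N ε₀ ζ Rz Zt) c₀).L : ℝ) / 2) ↔
      1250 * c₀.A₁ * c₀.K₀ * c₀.ε₁ * Real.exp (5 * 20000 + 1) * K₀ 64 8 * 9 * 64 ≤ 1 ∧ Real.exp 1 * 9 * 64 * K₀ 64 8 ^ 2 ≤ c₀.A₂ :=
  condsL_c13OfRecord₁₂_theta12OfFamily_iff F N ε₀ ζ Rz Zt c₀

/-- **NON-VACUITY BY NAME AT THE RE-PINNED WITNESS**: for any residual `c₀`, letters differing from `c₀` only in `ε₁ > 0` and `A₂` meet N1 at the letters of record of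
`θ₀ᶠᵃᵐ(ε₀)` — so p479720 §1 (`exists_chainTFac190H_view_of_family` … `d4AtSlopeOfD1Record12_at_of_family_leafwise`) is NOT vacuous in its `hC` slot there, in contrast
with `theta12OfRecord`.  (Satisfiability of ONE displayed hypothesis; the family road's other displayed inputs at the witness are untouched; nothing of Bałaban's.)
[cite: Balaban1988RG2Cluster, p.21 (after (2.39) and after (2.41)); Balaban1987RG1, (0.25)-(0.26) p.257 and (1.18) p.263] -/
theorem exists_condsL_c13OfRecord₁₂_theta12OfFamily :
    ∃ c : B13.Consts, 0 < c.ε₁ ∧ c = { c₀ with ε₁ := c.ε₁, A₂ := c.A₂ } ∧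
      CondsL 4 (c13OfRecord₁₂ F N (theta12OfFamily F N ε₀ ζ Rz Zt) c) (((c13OfRecord₁₂ F N (theta12OfFamily F N ε₀ ζ Rz Zt) c).L : ℝ) / 2) :=
  exists_condsL_c13OfRecord₁₂_half_of_kappa_ge F N _ (kappaThreshold_le_theta12OfFamily F N ε₀ ζ Rz Zt) c₀

/-- … and AT the live re-pin `θ₀ᶠᵃᵐ,ˡⁱᵛᵉ(ε₀)`. [cite: Balaban1988RG2Cluster, p.21 (after (2.39) and after (2.41)); Balaban1987RG1, (1.18) p.263] -/
theorem exists_condsL_c13OfRecord₁₂_theta12LiveOfFamily :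
    ∃ c : B13.Consts, 0 < c.ε₁ ∧ c = { c₀ with ε₁ := c.ε₁, A₂ := c.A₂ } ∧
      CondsL 4 (c13OfRecord₁₂ F N (theta12LiveOfFamily F N ε₀ ζ Rz Zt) c) (((c13OfRecord₁₂ F N (theta12LiveOfFamily F N ε₀ ζ Rz Zt) c).L : ℝ) / 2) :=
  exists_condsL_c13OfRecord₁₂_theta12OfFamily F N ε₀ ζ Rz Zt c₀

end AtFamilyWitness

end Summit.QuantumFields.YangMills.Theorems.BalabanUVNodesN26AtRecord12KappaSufficient

end
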